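import Literature.AlgebraicGeometry.HodgeTheory.HodgeConjecture
import Literature.AlgebraicGeometry.HodgeTheory.ComplexConjugationHolds
import Literature.AlgebraicGeometry.Motives.FamiliesVHS
import Literature.AlgebraicGeometry.Motives.Sweep1
import HarnessLib

/-!
# The Hodge conjecture for smooth projective varieties fibred in quadric hypersurfaces over a base of dimension ≤ 3 (Vial 2013, Prop. 7.4)

Family `hodge`, layer `Literature/AlgebraicGeometry/HodgeTheory`. A KNOWN CASE of the Hodge
conjecture, named fact (D-0014) on the tree's real carriers, in the pattern of the sibling
`ArapuraSurfaceFibredFourfolds` (`fiberOver`, `IsSmoothProjective`, `HodgeConjectureFor`).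

## The printed statement (read)

Ch. Vial, *Algebraic cycles and fibrations*, Doc. Math. 18 (2013) 1521–1553 = arXiv:1203.2650,
§7.2.1, verbatim (materialised text p. 20 L10–32): "7.2.1 Varieties fibred by quadric
hypersurfaces. Let `Q ⊂ ℙⁿ` be a quadric hypersurface. Then `CH_l(Q) = ℚ` for all `l < dim Q/2`.
**Proposition 7.4.** Let `f : X → B` be a dominant morphism between smooth projective complex
varieties whose closed fibres are quadric hypersurfaces. • If `dim B ≤ 1`, then `X` is Kimura
finite-dimensional and satisfies Murre's conjectures. • If `dim B ≤ 2`, then `X` satisfies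
Grothendieck's standard conjectures. • If `dim B ≤ 3`, then `X` satisfies the Hodge conjecture.
*Proof.* The fibers of `f` have dimension `≥ dim X − dim B`, so that `X` satisfies the assumptions
of Theorem 6.10 with `l = ⌊(d_X − d_B − 1)/2⌋`. Thus the Chow groups
`CH_0(X), …, CH_{⌊(d_X−d_B−1)/2⌋}(X)` have niveau `≤ d_B`. We can therefore conclude by Theorem 7.1."
Theorem 6.10 (ibid. p. 17): "Let `f : X → B` be a complex projective surjective morphism onto a
quasi-projective variety `B`. Assume that `CH_i(X_b) = ℚ` for all `i ≤ l` and all closed point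
`b ∈ B`. Then `CH_i(X)` has niveau `≤ d_B` for all `i ≤ l`." — the hypothesis is on CLOSED fibres
only and singular quadrics are intended (ibid. Cor. 4.4 "the geometric fibres of `f` could either
be quadrics or …", Rem. 4.7 on conic bundles with a discriminant curve; for a quadric of any rank
the localisation sequence gives `CH_l ⊗ ℚ = ℚ` for `l < dim Q/2`). Theorem 7.1 (i) (ibid. p. 19,
= Laterveer 1998): niveau `≤ 3` of `CH_0(X_Ω), …, CH_{⌊(d−4)/2⌋}(X_Ω)` implies the Hodge
conjecture for `X`. Only the third bullet is vendored here.

## Rendering and faithfulness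

* `X`, `B` range over `ℂ`-schemes with `Motives.IsSmoothProjective nX X`,
  `Motives.IsSmoothProjective nB B`, `nB ≤ 3` ("smooth projective complex varieties",
  `dim B ≤ 3`).
* "dominant": rendered as surjectivity of the underlying map of `f` (a dominant morphism of
  projective varieties is surjective; requiring surjectivity makes the hypothesis no weaker than
  the source's, hence the fact no stronger).
* "closed fibres are quadric hypersurfaces": for every `ℂ`-point `s` of `B` the fibre
  `X_s = Motives.fiberOver f s` is, for some `N` and some NONZERO quadratic form `q` in `N + 1`
  variables, a hypersurface cut out by `q` in `ℙᴺ_ℂ` in the tree's sense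
  `Motives.IsHypersurfaceCutOutBy N q X_s` (reduced, closed immersion onto `V₊(q)`). This covers
  every quadric of rank `≥ 2` (smooth or singular, e.g. the cones over the discriminant) and
  excludes only double hyperplanes (non-reduced) — a SUB-case of the printed hypothesis, so the
  `def` below is in no reading stronger than the source. `-- TODO(general form): non-reduced
  (rank-one) fibres, once the tree has graded quotients of `Proj`.`
* Conclusion: every rational class of Hodge type `(p,p)` in `H²ᵖ(X(ℂ); ℂ)` lies in
  `algebraicClasses X p`, for every `p` — the cycle conjunct of `HodgeConjectureFor nX X`; the
  model conjunct is the tree's theorem `nonempty_hodgeModel_holds`, and the proved corollary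
  `….hodgeConjectureFor` gives the summit layer's spelling.

## Why it is vendored (cell hodge-nonav, memo ROUTE-P3v3 §0, "chain C")

For a smooth complete intersection `V` of `c ≤ 4` quadrics in `ℙⁿ_ℂ` the total space
`X_Λ = {(λ, x) | x ∈ Q_λ} ⊂ ℙ^{c−1} × ℙⁿ` of the linear system is smooth projective, maps onto
`ℙ^{c−1}` (dimension `c − 1 ≤ 3`) with every closed fibre a quadric hypersurface of rank `≥ 2`, so
this fact gives `HodgeConjectureFor (n + c − 2) X_Λ`; Cayley's trick (Jiang, J. Inst. Math.
Jussieu 22 (2023), Thm. 3.1 / Cor. 3.2; O'Grady, Math. Ann. 273 (1986), Thm. 1.1 for nets) makes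
`h(V)(c−1)` a direct summand of `h(X_Λ)` by algebraic correspondences, whence HC for `V`. Neither
the construction of `X_Λ` nor the transfer is in this file.

## References

* [Vial2013] Ch. Vial, Algebraic cycles and fibrations, Doc. Math. 18 (2013) 1521–1553,
  Prop. 7.4 (§7.2.1, p. 20 of arXiv:1203.2650), Thm. 6.10 (p. 17), Thm. 7.1 (p. 19) — text read.
* [Laterveer1998] R. Laterveer, Algebraic varieties with small Chow groups, J. Math. Kyoto Univ.
  38 (1998) — the niveau-3 criterion quoted as Vial's Thm. 7.1 (i).
* [Jiang2023ChowProjectivizations] Q. Jiang, J. Inst. Math. Jussieu 22 (2023), Thm. 3.1, Cor. 3.2.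
* [Deligne2000] P. Deligne, The Hodge conjecture (Clay, 2000), §1.
-/

noncomputable section

namespace Literature.AlgebraicGeometry.HodgeTheory

section HodgeTheory

/-! ### The named fact -/

/-- **Vial 2013, Prop. 7.4, third bullet** (Doc. Math. 18 (2013), §7.2.1; the printed sentence
is quoted verbatim in the module docstring): for a dominant morphism `f : X → B` of smooth
projective complex varieties whose closed fibres are quadric hypersurfaces, `dim B ≤ 3` implies
that every rational `(p,p)`-class on `X` is algebraic. Rendering: `X` smooth projective of
dimension `nX`, `B` smooth projective of dimension `nB ≤ 3` over `ℂ`, `f : X ⟶ B` surjective on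
points, and for every `ℂ`-point `s` of `B` the fibre `X_s` is a reduced hypersurface cut out in
some `ℙᴺ_ℂ` by a nonzero quadratic form (every quadric of rank `≥ 2`, singular ones included;
rank one excluded — a sub-case of the source); then every rational `(p,p)`-class in
`H²ᵖ(X(ℂ); ℂ)` lies in `algebraicClasses X p` (a THEOREM in print, proved loc. cit. from
Thm. 6.10 and Laterveer's niveau criterion, Thm. 7.1 (i); the summit layer's spelling is the
proved corollary right below).
[cite: Vial2013, Prop. 7.4 (iii) (§7.2.1), with Thm. 6.10 and Thm. 7.1 (i)] -/
def Vial2013_quadricFibration_hodgeClasses_algebraic : Prop :=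
  ∀ ⦃nX nB : ℕ⦄ ⦃X B : Motives.SchemeOver ℂ⦄ (f : X ⟶ B),
    Motives.IsSmoothProjective nX X → Motives.IsSmoothProjective nB B → nB ≤ 3 →
    Function.Surjective f.left.base →
    (∀ s : Motives.AlgPoints B ℂ, ∃ (N : ℕ) (q : MvPolynomial (Fin (N + 1)) ℂ),
      q.IsHomogeneous 2 ∧ q ≠ 0 ∧ Motives.IsHypersurfaceCutOutBy N q (Motives.fiberOver f s)) →
    ∀ (p : ℕ) (c : Literature.AlgebraicTopology.SingularHomology.singularCohomology ℂ ℂ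
        (Motives.ComplexPoints X) (2 * p)),
      IsRationalClass c → IsOfHodgeType nX X (2 * p) p p c → c ∈ algebraicClasses X p

/-! ### The summit layer's spelling `HodgeConjectureFor` (model conjunct is a theorem of the tree) -/

/-- **Vial's Prop. 7.4 (iii) in the spelling `HodgeConjectureFor nX X`**: the cycle conjunct is the
fact, the Hodge-model conjunct is the tree's theorem `nonempty_hodgeModel_holds` (Serre GAGA,
Hodge decomposition). [cite: Vial2013, Prop. 7.4 (iii)] -/
theorem Vial2013_quadricFibration_hodgeClasses_algebraic.hodgeConjectureFor
    (h : Vial2013_quadricFibration_hodgeClasses_algebraic)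
    {nX nB : ℕ} {X B : Motives.SchemeOver ℂ} (f : X ⟶ B)
    (hX : Motives.IsSmoothProjective nX X) (hB : Motives.IsSmoothProjective nB B) (hnB : nB ≤ 3)
    (hf : Function.Surjective f.left.base)
    (hq : ∀ s : Motives.AlgPoints B ℂ, ∃ (N : ℕ) (q : MvPolynomial (Fin (N + 1)) ℂ),
      q.IsHomogeneous 2 ∧ q ≠ 0 ∧ Motives.IsHypersurfaceCutOutBy N q (Motives.fiberOver f s)) :
    HodgeConjectureFor nX X :=
  ⟨nonempty_hodgeModel_holds hX, h f hX hB hnB hf hq⟩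

/-! ### Upper bound: the fact is an instance of the summit statement -/

/-- Upper bound: the summit statement (every rational `(p,p)`-class on every smooth projective
complex variety is algebraic, spelled with `HodgeConjectureFor`) implies Vial's Prop. 7.4 (iii) —
its instance on the total space `X`, all fibration hypotheses dropped.
[cite: Deligne2000, §1] [cite: Vial2013, Prop. 7.4 (iii)] -/
theorem Vial2013_quadricFibration_hodgeClasses_algebraic_of_hodgeConjectureFor
    (h : ∀ ⦃n : ℕ⦄ ⦃X : Motives.SchemeOver ℂ⦄, Motives.IsSmoothProjective n X → HodgeConjectureFor n X) :
    Vial2013_quadricFibration_hodgeClasses_algebraic :=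
  fun _ _ _ _ _ hX _ _ _ _ p c hc hpp ↦ (h hX).2 p c hc hpp

/-! ### The base dimensions used by chain C (`B = ℙ^{c−1}`, `c ≤ 4`) -/

/-- **Unfolding at the base dimensions of chain C**: for a quadric fibration (in the above sense)
over a smooth projective base of dimension `c − 1` with `c ≤ 4` — the linear system `ℙ^{c−1}` of
`c ≤ 4` quadrics — every rational `(p,p)`-class on the total space is algebraic.
[cite: Vial2013, Prop. 7.4 (iii)] -/
theorem Vial2013_quadricFibration_hodgeClasses_algebraic.of_le_four
    (h : Vial2013_quadricFibration_hodgeClasses_algebraic)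
    {nX c : ℕ} (hc : c ≤ 4) {X B : Motives.SchemeOver ℂ} (f : X ⟶ B)
    (hX : Motives.IsSmoothProjective nX X) (hB : Motives.IsSmoothProjective (c - 1) B)
    (hf : Function.Surjective f.left.base)
    (hq : ∀ s : Motives.AlgPoints B ℂ, ∃ (N : ℕ) (q : MvPolynomial (Fin (N + 1)) ℂ),
      q.IsHomogeneous 2 ∧ q ≠ 0 ∧ Motives.IsHypersurfaceCutOutBy N q (Motives.fiberOver f s)) :
    HodgeConjectureFor nX X :=
  h.hodgeConjectureFor f hX hB (by omega) hf hq

end HodgeTheory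

end Literature.AlgebraicGeometry.HodgeTheory

end
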